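import Summits.BirchSwinnertonDyer.Rank1Residual.X1.CongruenceTransfer
import Literature.NumberTheory.EllipticCurves.EmertonPollackWeston2006.NearlyOrdinaryAlgebraicTransfer
import HarnessLib

/-!
# Route G at an ADDITIVE potentially-ordinary prime: the typed input `CongruentLambdaShift` and the
# `μ = 0` transfer DISCHARGED for congruent additive pairs from the cited EPW06 algebraic transfer
# (cell `b2b-bsdres`, lane CLASS-CLOSURE, seat cc-typer-1 = typer of record N11 / O8; ruling R5-20)

HONEST FRAMING (cell `b2b-bsdres`, run/shared/lean/b2b/bsd-rank1-residual/, verbatim in every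
file): the goal of the cell is to DELETE the COMBINATION-SHAPED residual classes of the
Birch–Swinnerton-Dyer formula for ALL analytic-rank `≤ 1` elliptic curves over `ℚ` — "full BSD
formula for every rank `≤ 1` curve in class `C`" assembled STRICTLY from published theorems — so
that the rank-`≤ 1` remainder becomes exactly the CONSTRUCTION-SHAPED classes, which are TYPED
(missing-input `Prop`s), NOT attempted. This is not "finishing BSD". Lane CLASS-CLOSURE: research
routes, no claim beyond the stated classes; census output = EVIDENCE, never a Literature fact;
NOTHING is booked here. Theorems only (no definition, no named fact): the transport lemma of the
typer's payload (c) "congruence" for the classes N11 / O8 (and N10's X4 rows), as a precise comparison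
statement WITH its printed antecedent — Emerton–Pollack–Weston 2006 Thm. 3.3.2 / Thm. 3.3.3 (2) /
Lemma 5.1.5, vendored as the ONE named fact
`EmertonPollackWeston2006.muLambdaAlg_transfer_of_torsionIso_potOrd`
(`Literature/…/EmertonPollackWeston2006/NearlyOrdinaryAlgebraicTransfer.lean`).

* `congruentLambdaShift_of_epw` — for `W₁, W₂/ℚ` globally minimal, `p ≠ 2`, ramified ordinary lines
  `L₁, L₂` at the place `v ∋ p` (`IsRamifiedOrdinaryLine`: additive potentially-ordinary reduction, EPW's
  `A'`), `E₁[p]` irreducible, a `Γ_ℚ`-equivariant `E₁[p] ≃ E₂[p]` carrying `C₁[p]` to `C₂[p]`, and `Σ₀ ∌ p`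
  outside which both curves are good: `X1.CongruenceTransfer.CongruentLambdaShift W₁ W₂ p
  (Σ_{v∈Σ₀} (δ(E₂,v) − δ(E₁,v)))`, `δ = GreenbergVatsal2000.delta = s_ℓ d_ℓ` — the additive-prime
  twin of `X2.CongruentLambdaShiftDerived.congruentLambdaShift_of_facts` (good ordinary `p`, GV §2).
  This is the binder `CongruentLambdaShift` of n1011-p10's `Additive/CongruentPartnerMainConjecture.lean`
  (K-C / K-C′, ROUTE-2 §II.10) with the shift `e` EXPLICIT.
* `mu_eq_zero_of_epw` — under the same hypotheses `μ(X(E₁)) = 0 ⟹ μ(X(E₂)) = 0` (EPW Thm. 3.3.2),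
  the input Route G's kernel otherwise takes from Kato's INTEGRAL divisibility at `E₂` — so the
  image-free rows (class O8) get it from the partner.
* `congruentLambdaShift_zero_of_epw` — equal local terms ⇒ `CongruentLambdaShift W₁ W₂ p 0`.

References: EPW 2006 Thms. 3.3.2, 3.3.3, Lemma 5.1.5 (arXiv:math/0404484 pp. 19, 30)
[EmertonPollackWeston2006]; GV 2000 §2 Prop. (2.4) [GreenbergVatsal2000]; ROUTE-2.md §II.9–II.10;
class-closure/typer-1/R5-20-EPW-ALGEBRAIC-TRANSFER.md.
-/

noncomputable section

open scoped Classical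

open NumberField IsDedekindDomain Field WeierstrassCurve
  Literature.NumberTheory.GaloisRepresentations
  Literature.NumberTheory.EllipticCurves
  Literature.NumberTheory.EllipticCurves.GreenbergSelmer
  Literature.NumberTheory.EllipticCurves.GreenbergVatsal2000
  Literature.NumberTheory.EllipticCurves.EmertonPollackWeston2006
  Summit.BirchSwinnertonDyer.Rank1Residual.X1.CongruenceTransfer

namespace Summit.BirchSwinnertonDyer.Rank1Residual.Additive

variable (W₁ W₂ : WeierstrassCurve ℚ) [W₁.IsElliptic] [W₁.IsGloballyMinimal] [W₂.IsElliptic]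
  [W₂.IsGloballyMinimal] (p : ℕ) [Fact p.Prime] (S₀ : Finset (HeightOneSpectrum (𝓞 ℚ)))

/-- **Route G's typed input at an additive potentially-ordinary prime: `CongruentLambdaShift W₁ W₂ p e`
with `e = Σ_{v∈Σ₀} (δ(E₂,v) − δ(E₁,v))`, from the cited EPW06 algebraic transfer.** Hypotheses: the
named fact `hEPW`, `p ≠ 2`, the place `v ∋ p`, ramified ordinary lines `L₁`, `L₂` (`IsRamifiedOrdinaryLine`),
`E₁[p]` irreducible, a `Γ_ℚ`-equivariant `E₁[p] ≃ E₂[p]` carrying `C₁[p]` to `C₂[p]`, `Σ₀ ∌ p` outside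
which both curves have good reduction. (The `TorsionIso` premise inside `CongruentLambdaShift` is
implied by, and weaker than, the line-respecting isomorphism, which is what the branch bookkeeping
needs; the second `μ = 0` premise inside the schema is not used — it is transferred.)
[cite: EmertonPollackWeston2006, Thm. 3.3.3 (2) (arXiv:math/0404484 p. 19) and Lemma 5.1.5 (p. 30)] -/
theorem congruentLambdaShift_of_epw (hEPW : muLambdaAlg_transfer_of_torsionIso_potOrd) (hp : p ≠ 2)
    {v : HeightOneSpectrum (𝓞 ℚ)} (hv : ((p : ℕ) : 𝓞 ℚ) ∈ v.asIdeal)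
    {L₁ : LocalDatum ℚ (W₁.geomPrimaryTorsion p) v} {L₂ : LocalDatum ℚ (W₂.geomPrimaryTorsion p) v}
    (hL₁ : IsRamifiedOrdinaryLine W₁ p L₁) (hL₂ : IsRamifiedOrdinaryLine W₂ p L₂)
    (hirr : W₁.HasIrreducibleModPGaloisRep p)
    (hiso : ∃ e : geomTorsion W₁ (p : ℤ) ≃+ geomTorsion W₂ (p : ℤ),
      (∀ (σ : absoluteGaloisGroup ℚ) (P : geomTorsion W₁ (p : ℤ)), e (σ • P) = σ • e P) ∧
      (∀ P : geomTorsion W₁ (p : ℤ),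
        AddSubgroup.inclusion (geomTorsion_le_geomPrimaryTorsion W₁ p) P ∈ L₁.plus ↔
          AddSubgroup.inclusion (geomTorsion_le_geomPrimaryTorsion W₂ p) (e P) ∈ L₂.plus))
    (hS₀ : ∀ w ∈ S₀, ((p : ℕ) : 𝓞 ℚ) ∉ w.asIdeal)
    (hS₁ : ∀ w : HeightOneSpectrum (𝓞 ℚ), w ∉ S₀ → ((p : ℕ) : 𝓞 ℚ) ∉ w.asIdeal →
      W₁.HasGoodReductionAt w)
    (hS₂ : ∀ w : HeightOneSpectrum (𝓞 ℚ), w ∉ S₀ → ((p : ℕ) : 𝓞 ℚ) ∉ w.asIdeal →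
      W₂.HasGoodReductionAt w) :
    CongruentLambdaShift W₁ W₂ p (∑ w ∈ S₀, ((delta W₂ p w : ℤ) - (delta W₁ p w : ℤ))) := by
  intro _ κ γ hκ hγ hγ' D₁ D₂ _ _ hX₁ hX₂ hμ₁ _
  obtain ⟨-, hlam⟩ := hEPW W₁ W₂ p hp v hv L₁ L₂ hL₁ hL₂ hirr hiso S₀ hS₀ hS₁ hS₂ κ γ hκ hγ hγ' D₁ D₂
    hX₁ hX₂ hμ₁
  rw [Finset.sum_sub_distrib]
  have h' : ((lambdaInvariant p D₁.X + ∑ w ∈ S₀, delta W₁ p w : ℕ) : ℤ) =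
      ((lambdaInvariant p D₂.X + ∑ w ∈ S₀, delta W₂ p w : ℕ) : ℤ) := by rw [hlam]
  push_cast at h'
  linarith

/-- **The `μ = 0` transfer along an additive congruence** (EPW Thm. 3.3.2 on the ramified branch):
same hypotheses; for the cyclotomic data and all finitely generated `Λ`-torsion dual data,
`μ(X(E₁)) = 0 ⟹ μ(X(E₂)) = 0`. [cite: EmertonPollackWeston2006, Thm. 3.3.2 (arXiv:math/0404484 p. 19)] -/
theorem mu_eq_zero_of_epw (hEPW : muLambdaAlg_transfer_of_torsionIso_potOrd) (hp : p ≠ 2)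
    {v : HeightOneSpectrum (𝓞 ℚ)} (hv : ((p : ℕ) : 𝓞 ℚ) ∈ v.asIdeal)
    {L₁ : LocalDatum ℚ (W₁.geomPrimaryTorsion p) v} {L₂ : LocalDatum ℚ (W₂.geomPrimaryTorsion p) v}
    (hL₁ : IsRamifiedOrdinaryLine W₁ p L₁) (hL₂ : IsRamifiedOrdinaryLine W₂ p L₂)
    (hirr : W₁.HasIrreducibleModPGaloisRep p)
    (hiso : ∃ e : geomTorsion W₁ (p : ℤ) ≃+ geomTorsion W₂ (p : ℤ),
      (∀ (σ : absoluteGaloisGroup ℚ) (P : geomTorsion W₁ (p : ℤ)), e (σ • P) = σ • e P) ∧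
      (∀ P : geomTorsion W₁ (p : ℤ),
        AddSubgroup.inclusion (geomTorsion_le_geomPrimaryTorsion W₁ p) P ∈ L₁.plus ↔
          AddSubgroup.inclusion (geomTorsion_le_geomPrimaryTorsion W₂ p) (e P) ∈ L₂.plus))
    (hS₀ : ∀ w ∈ S₀, ((p : ℕ) : 𝓞 ℚ) ∉ w.asIdeal)
    (hS₁ : ∀ w : HeightOneSpectrum (𝓞 ℚ), w ∉ S₀ → ((p : ℕ) : 𝓞 ℚ) ∉ w.asIdeal →
      W₁.HasGoodReductionAt w)
    (hS₂ : ∀ w : HeightOneSpectrum (𝓞 ℚ), w ∉ S₀ → ((p : ℕ) : 𝓞 ℚ) ∉ w.asIdeal →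
      W₂.HasGoodReductionAt w)
    {κ : ZpExtension ℚ p} {γ : absoluteGaloisGroup ℚ} (hκ : κ.IsCyclotomic)
    (hγ : κ.IsTopGenerator γ) (hγ' : IsCyclotomicVariable p γ)
    (D₁ : W₁.SelmerDualData κ γ) (D₂ : W₂.SelmerDualData κ γ)
    [Module.Finite (IwasawaAlgebra p) D₁.X] [Module.Finite (IwasawaAlgebra p) D₂.X]
    (hX₁ : D₁.IsTorsion) (hX₂ : D₂.IsTorsion) (hμ₁ : D₁.mu = 0) : D₂.mu = 0 :=
  (hEPW W₁ W₂ p hp v hv L₁ L₂ hL₁ hL₂ hirr hiso S₀ hS₀ hS₁ hS₂ κ γ hκ hγ hγ' D₁ D₂ hX₁ hX₂ hμ₁).1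

/-- **Equal local terms ⇒ `CongruentLambdaShift W₁ W₂ p 0`** (same `λ` for congruent additive curves
whose Euler factors agree mod `p` at the bad places away from `p`).
[cite: EmertonPollackWeston2006, Thm. 3.3.3 (arXiv:math/0404484 p. 19)] -/
theorem congruentLambdaShift_zero_of_epw (hEPW : muLambdaAlg_transfer_of_torsionIso_potOrd)
    (hp : p ≠ 2) {v : HeightOneSpectrum (𝓞 ℚ)} (hv : ((p : ℕ) : 𝓞 ℚ) ∈ v.asIdeal)
    {L₁ : LocalDatum ℚ (W₁.geomPrimaryTorsion p) v} {L₂ : LocalDatum ℚ (W₂.geomPrimaryTorsion p) v}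
    (hL₁ : IsRamifiedOrdinaryLine W₁ p L₁) (hL₂ : IsRamifiedOrdinaryLine W₂ p L₂)
    (hirr : W₁.HasIrreducibleModPGaloisRep p)
    (hiso : ∃ e : geomTorsion W₁ (p : ℤ) ≃+ geomTorsion W₂ (p : ℤ),
      (∀ (σ : absoluteGaloisGroup ℚ) (P : geomTorsion W₁ (p : ℤ)), e (σ • P) = σ • e P) ∧
      (∀ P : geomTorsion W₁ (p : ℤ),
        AddSubgroup.inclusion (geomTorsion_le_geomPrimaryTorsion W₁ p) P ∈ L₁.plus ↔
          AddSubgroup.inclusion (geomTorsion_le_geomPrimaryTorsion W₂ p) (e P) ∈ L₂.plus))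
    (hS₀ : ∀ w ∈ S₀, ((p : ℕ) : 𝓞 ℚ) ∉ w.asIdeal)
    (hS₁ : ∀ w : HeightOneSpectrum (𝓞 ℚ), w ∉ S₀ → ((p : ℕ) : 𝓞 ℚ) ∉ w.asIdeal →
      W₁.HasGoodReductionAt w)
    (hS₂ : ∀ w : HeightOneSpectrum (𝓞 ℚ), w ∉ S₀ → ((p : ℕ) : 𝓞 ℚ) ∉ w.asIdeal →
      W₂.HasGoodReductionAt w)
    (hδ : ∀ w ∈ S₀, delta W₁ p w = delta W₂ p w) :
    CongruentLambdaShift W₁ W₂ p 0 := by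
  have h := congruentLambdaShift_of_epw W₁ W₂ p S₀ hEPW hp hv hL₁ hL₂ hirr hiso hS₀ hS₁ hS₂
  have h0 : ∑ w ∈ S₀, ((delta W₂ p w : ℤ) - (delta W₁ p w : ℤ)) = 0 :=
    Finset.sum_eq_zero fun w hw ↦ by rw [hδ w hw, sub_self]
  rwa [h0] at h

end Summit.BirchSwinnertonDyer.Rank1Residual.Additive

end
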